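import Summits.RiemannHypothesis.RiemannHypothesis.Theorems.UniversalFactorLaguerreLift

/-!
# RiemannHypothesis / UniversalFactor — the target `LaplaceLoophole` (item stmt-RiemannHypothesis-2575): bookkeeping

Route `RiemannHypothesis/UniversalFactor`, target X = `UniversalFactor.LaplaceLoophole`:
`∃ a > 0, HasOnlyRealZeros F_a`, `F_a(z) = ∫₀^∞ Φ(u)(1 + u²/a²)⁻¹ cos(zu) du` (Cardon's Question 7 on
the Laplace ray of de Bruijn's universal-factor cone). This support file records, sorry-free and
unconditionally, what the tree knows about X as filed:

* `UniversalFactor.laplaceLoophole_iff` — X is verbatim `∃ a > 0, HasOnlyRealZeros (deBruijnHDiv (1 + u²/a²))`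
  (`Iff.rfl`; all of `DeBruijnHDiv.lean` — entirety, evenness, realness, the ODE
  `F_a − F_a''/a² = H_0` — applies to the target's function);
* `UniversalFactor.riemannHypothesis_of_laplaceLoophole` — **X → RH** (Mathlib's `RiemannHypothesis`),
  the positive side, from `UniversalFactor.assembly` (`UniversalFactorLaguerreLift.lean`);
* `UniversalFactor.not_laplaceLoophole_of_noGo` — **the typed kill path**: the four no-go decls
  `NarrowKernelNoGo` (a ≥ 32), `MediumKernelNoGo` (π/8 ≤ a ≤ 32), `WideKernelNoGo` and
  `ExceptionalWideNoGo` (0 < a < π/8, according as `∫₀^∞ H_0 cosh(a·) ≠ 0` or `= 0`) together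
  refute X (case split at `π/8` and `32`), so that X closes `refuted` in one line once items
  stmt-2576, 2577, 2578, 2583 do;
* `UniversalFactor.lehmerPointNoGo_of_mediumKernelNoGo` — the calibration point `a = 16` is an
  instance of the medium window (`3 < π < 4`).

Nothing here decides X; the file is `--supports stmt-RiemannHypothesis-2575`.
-/

noncomputable section

namespace Summit.RiemannHypothesis.RiemannHypothesis.Theorems

open Literature.NumberTheory.LFunctions
open Summit.RiemannHypothesis.RiemannHypothesis.Theses

/-- X, verbatim, is real-rootedness of `deBruijnHDiv (fun u ↦ 1 + u²/a²)` for some `a > 0`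
(the route inlines the integral defining `deBruijnHDiv`; cf. `deBruijnHDiv_laplace_eq`). [folklore] -/
theorem UniversalFactor.laplaceLoophole_iff :
    UniversalFactor.LaplaceLoophole ↔
      ∃ a : ℝ, 0 < a ∧ HasOnlyRealZeros (deBruijnHDiv fun u : ℝ => 1 + u ^ 2 / a ^ 2) :=
  Iff.rfl

/-- **X → RH**: the target implies Mathlib's `RiemannHypothesis` (Cardon 2002, §3 Question 7:
"This would prove the Riemann Hypothesis!"), by `UniversalFactor.assembly` (the Laguerre lift
through `1 − D²/a²` and `RH ↔ H_0` real-rooted). [folklore] -/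
theorem UniversalFactor.riemannHypothesis_of_laplaceLoophole (h : UniversalFactor.LaplaceLoophole) :
    _root_.RiemannHypothesis :=
  Summit.RiemannHypothesis_iff.mp (UniversalFactor.assembly h)

/-- **The kill path** (route thesis, "kill criteria (ii)"): generalised Newman in the narrow
(`a ≥ 32`), medium (`π/8 ≤ a ≤ 32`), wide (`0 < a < π/8`, `∫₀^∞ H_0 cosh(a·) ≠ 0`) and exceptional
wide (`= 0`) windows together give `¬ X`. Purely propositional (case split at `π/8` and `32`).
[folklore] -/
theorem UniversalFactor.not_laplaceLoophole_of_noGo (hN : UniversalFactor.NarrowKernelNoGo)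
    (hM : UniversalFactor.MediumKernelNoGo) (hW : UniversalFactor.WideKernelNoGo)
    (hE : UniversalFactor.ExceptionalWideNoGo) : ¬ UniversalFactor.LaplaceLoophole := by
  rintro ⟨a, ha, h⟩
  rcases lt_or_ge a (Real.pi / 8) with h1 | h1
  · by_cases hC : (∫ x in Set.Ioi (0:ℝ), deBruijnH 0 (x : ℂ) * (Real.cosh (a * x) : ℂ)) = 0
    · exact hE a ha h1 hC h
    · exact hW a ha h1 hC h
  · rcases le_or_gt a 32 with h2 | h2
    · exact hM a h1 h2 h
    · exact hN a h2.le h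

/-- The medium window contains the calibration point `a = 16` of item `LehmerPointNoGo`
(`π/8 ≤ 16 ≤ 32`). [folklore] -/
theorem UniversalFactor.lehmerPointNoGo_of_mediumKernelNoGo (hM : UniversalFactor.MediumKernelNoGo) :
    UniversalFactor.LehmerPointNoGo := by
  have hπ : Real.pi / 8 ≤ 16 := by linarith [Real.pi_lt_four]
  exact hM 16 hπ (by norm_num)

end Summit.RiemannHypothesis.RiemannHypothesis.Theorems
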